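import Summits.Ventures.HodgeRepro2.T5SU11KernelDerivative

/-!
# The second-order Taylor remainder of the kernel in the spectral parameter

The kernel resolvent identity `K_λ(t, s) − K_{λ₂}(t, s) = (μ − μ₂) G^I_λ k_s(t)` (`k_s = K_{λ₂}(·, s)`, row 5xx) and the
resolvent identity on the source `k_s ∈ W_1` (row 575) give the exact second-order term
`K_λ − K_{λ₂} − (μ − μ₂) K_{λ₂} ∘ K_{λ₂} = (μ − μ₂)² G^I_λ(G^I_{λ₂} k_s)`, whence, with the `W_1` constant `D_s` of `k_s`:

* `kernel_sub_sub_eq` — **the exact second-order identity**;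
* `abs_kernel_sub_sub_le` — **`|K_λ(t, s) − K_{λ₂}(t, s) − (μ − μ₂)(K_{λ₂} ∘ K_{λ₂})(t, s)| ≤ (μ − μ₂)² D_s Ξ(t)/((λ − 1)²(λ₂ − 1)²)`**
  — the derivative `∂_μ K = K ∘ K` of row 575 with an explicit, `t`-uniform (in the `Ξ`-weighted sense) remainder.

Nothing is claimed about (N).

Blind lane: Mathlib + the HodgeRepro2 prefix only; no sorry; axioms ⊆ {propext, Classical.choice,
Quot.sound}.
-/

namespace Summit.Ventures.HodgeRepro2.T5SU11KernelTaylor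

open Filter Topology MeasureTheory
open Set (Ioi Ioc)
open T5SU11Cartan T5SU11SphericalFunction T5SU11SphericalDecay T5SU11RadialGreenKernel T5SU11RadialGreenImproper
  T5SU11KernelDifferenceRegularity T5SU11ResolventGroundStateWeight T5SU11WeightedSpaceGroundState
  T5SU11KernelDerivative

section measure

variable [MeasurableSpace Circle] [BorelSpace Circle]

variable {lam lam₂ : ℝ} (hlam : 1 < lam) (hlam₂ : 1 < lam₂) {s : ℝ} (hs : 0 < s)

include hlam hlam₂ hs in
/-- **The exact second-order identity of the kernel**:
`K_λ(t, s) − K_{λ₂}(t, s) − (μ − μ₂) (K_{λ₂} ∘ K_{λ₂})(t, s) = (μ − μ₂)² G^I_λ(G^I_{λ₂} K_{λ₂}(·, s))(t)`. -/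
theorem kernel_sub_sub_eq {t : ℝ} (ht : 0 < t) :
    sphGreenKernel lam t s - sphGreenKernel lam₂ t s
        - (lam * (lam - 2) - lam₂ * (lam₂ - 2))
          * ∫ r in Ioi 0, sphGreenKernel lam₂ t r * sphGreenKernel lam₂ r s * Real.sinh (2 * r)
      = (lam * (lam - 2) - lam₂ * (lam₂ - 2)) ^ 2 * greenSolI (fun t => sph lam (hyp t)) (sphDecay lam)
          (greenSolI (fun t => sph lam₂ (hyp t)) (sphDecay lam₂) (fun r => sphGreenKernel lam₂ r s)) t := by
  set κ := lam * (lam - 2) - lam₂ * (lam₂ - 2) with hκ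
  obtain ⟨D, _, hD⟩ := kernel_source_mem_weighted_one hlam₂ hs
  have hg := kernel_source_continuousOn hlam₂ hs
  rw [← greenSolI_kernel_source_eq_integral hlam₂ hs ht]
  rcases eq_or_ne lam lam₂ with heq | hne
  · subst heq
    simp [hκ]
  · have hμne : κ ≠ 0 := by
      have e : κ = (lam - lam₂) * (lam + lam₂ - 2) := by rw [hκ]; ring
      rw [e]
      exact mul_ne_zero (sub_ne_zero.mpr hne) (by linarith)
    -- `K_λ − K_{λ₂} = κ G^I_λ k_s`, and `G^I_λ k_s − G^I_{λ₂} k_s = κ G^I_λ(G^I_{λ₂} k_s)` (row 557's identity on `W_1`)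
    have h1 : sphGreenKernel lam t s - sphGreenKernel lam₂ t s
        = κ * greenSolI (fun t => sph lam (hyp t)) (sphDecay lam) (fun r => sphGreenKernel lam₂ r s) t := by
      rw [greenSolI_kernel_eq hlam hlam₂ hs hne ht, ← hκ, mul_div_cancel₀ _ hμne]
    have hmin : 1 < min lam lam₂ := lt_min hlam hlam₂
    obtain ⟨hM, hD0, hε, C, hC⟩ := class_of_le_mul_sph_one hmin hD
    have hε₁ : 2 - lam < (3 - min lam lam₂) / 2 := by linarith [min_le_left lam lam₂]
    have hε₂ : 2 - lam₂ < (3 - min lam lam₂) / 2 := by linarith [min_le_right lam lam₂]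
    have h2 := T5SU11ResolventIdentityDecay.greenSolI_sub_greenSolI_eq hlam hlam₂ hg hM hD0 hε₁ hε₂ hC ht
    rw [← hκ] at h2
    rw [h1]
    linear_combination κ * h2

include hlam hlam₂ hs in
/-- **THE SECOND-ORDER TAYLOR REMAINDER OF THE KERNEL**: with `D_s` the `W_1` constant of `K_{λ₂}(·, s)`,
`|K_λ(t, s) − K_{λ₂}(t, s) − (μ − μ₂)(K_{λ₂} ∘ K_{λ₂})(t, s)| ≤ (μ − μ₂)² D_s Ξ(t)/((λ − 1)² (λ₂ − 1)²)`. -/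
theorem abs_kernel_sub_sub_le :
    ∃ D : ℝ, 0 ≤ D ∧ ∀ t, 0 < t →
      |sphGreenKernel lam t s - sphGreenKernel lam₂ t s
        - (lam * (lam - 2) - lam₂ * (lam₂ - 2))
          * ∫ r in Ioi 0, sphGreenKernel lam₂ t r * sphGreenKernel lam₂ r s * Real.sinh (2 * r)|
      ≤ (lam * (lam - 2) - lam₂ * (lam₂ - 2)) ^ 2 * D * sph 1 (hyp t) / ((lam - 1) ^ 2 * (lam₂ - 1) ^ 2) := by
  obtain ⟨D, hD0, hD⟩ := kernel_source_mem_weighted_one hlam₂ hs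
  have hg := kernel_source_continuousOn hlam₂ hs
  refine ⟨D, hD0, fun t ht => ?_⟩
  rw [kernel_sub_sub_eq hlam hlam₂ hs ht, abs_mul, abs_pow, sq_abs]
  -- `G^I_{λ₂} k_s ∈ W_1` with the constant `D/(λ₂ − 1)²`, then the sharp bound at `λ`
  obtain ⟨hcont₂, hbound₂⟩ := greenSolI_mem_weighted_one hlam₂ hg hD
  have hstep := abs_greenSolI_le_mul_sph_one' hlam hcont₂ hbound₂ ht
  have hp1 : 0 < (lam - 1) ^ 2 := by
    have : 0 < lam - 1 := by linarith
    positivity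
  have hp2 : 0 < (lam₂ - 1) ^ 2 := by
    have : 0 < lam₂ - 1 := by linarith
    positivity
  calc (lam * (lam - 2) - lam₂ * (lam₂ - 2)) ^ 2
        * |greenSolI (fun t => sph lam (hyp t)) (sphDecay lam)
          (greenSolI (fun t => sph lam₂ (hyp t)) (sphDecay lam₂) (fun r => sphGreenKernel lam₂ r s)) t|
      ≤ (lam * (lam - 2) - lam₂ * (lam₂ - 2)) ^ 2 * (D / (lam₂ - 1) ^ 2 * sph 1 (hyp t) / (lam - 1) ^ 2) :=
        mul_le_mul_of_nonneg_left hstep (sq_nonneg _)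
    _ = (lam * (lam - 2) - lam₂ * (lam₂ - 2)) ^ 2 * D * sph 1 (hyp t) / ((lam - 1) ^ 2 * (lam₂ - 1) ^ 2) := by
        field_simp

end measure

end Summit.Ventures.HodgeRepro2.T5SU11KernelTaylor
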